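import Literature.MathematicalPhysics.QuantumFieldTheory.FinTorusTimeCovering
import Literature.MathematicalPhysics.QuantumFieldTheory.PlaquetteSystemLocalIso
import Literature.MathematicalPhysics.QuantumFieldTheory.AnisotropicTwistedPartitionFunctionStrongCoupling
import HarnessLib

/-!
# Aspect comparison of 't Hooft boxes at strong coupling: `|ln Z(L_s³ × 2n) - 2 ln Z(L_s³ × n)| ≤ 24 L_s³ n e^{-(R+1)}` (`2R < n`)

Topic `Literature/MathematicalPhysics/QuantumFieldTheory`; vocabulary of `FinTorusTimeCovering.lean` (the `2 : 1` time covering `plaqFold` of the box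
`n₀×n₁×n₂×(n+n)` onto `n₀×n₁×n₂×n`, its local sections, injectivity on time balls), `PlaquetteSystemLocalPressure.lean` (`localClusterSum`,
`ln Z = Σ_p g_R(p)` up to anchored tails `e^{-(R+1)}`), `PlaquetteSystemLocalIso.lean` (local isomorphisms transport `g_R`) and
`AnisotropicTwistedPartitionFunctionStrongCoupling.lean` (the bridge `wilsonFinTorusPartition = e^{-βN#P}·Z_{finTorusSystem}(Wilson family)`).
THEOREMS ONLY — the finite-size bookkeeping of R. Kotecký, D. Preiss, CMP 103 (1986) 491 [KoteckyPreiss1986] p. 493 ("good control of boundary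
terms") / G. Münster, Nucl. Phys. B180 (1981) 23, for the plaquette gas of Wilson's theory on 't Hooft's boxes (G. 't Hooft, Nucl. Phys. B153 (1979)
141 [tHooft1979Flux] §2), in the form needed by LINE g21-A `MagneticFluxCeiling` (planner ym-idea-4 RUNG-PLAN-K2, ⟨stmt-QuantumFields-25308⟩
`AspectOnePurity`, rung `stub_strongCouplingPurity`):

* `linkRel_plaqFold_iff'` — sharing a link is equivalent before/after folding on a time ball;
* `card_filter_plaqFold_eq`, `sum_comp_plaqFold` — the fibres of the covering have two elements: `Σ_{q} f(fold q) = 2 Σ_p f(p)`;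
* ★ `localClusterSum_plaqFold` — `g_R^{(2n)}(p') = g_R^{(n)}(fold p')` for `2R < n` (instance of `PlaquetteSystem.localClusterSum_eq_of_localIso`);
* ★★ `abs_log_Z_fold_sub_two_mul_le` — `|ln Z_{2n}(w ∘ fold) - 2 ln Z_n(w)| ≤ 2·#P(2n)·e^{-(R+1)}` for any measurable KP-small family `w`;
* `wilsonFinTorusPartition_eq_mul_Z` (untwisted bridge), ★★ `abs_log_wilsonFinTorusPartition_double_sub_le` — for second-countable compact `G`,
  continuous `ρ : G →* M_N(ℂ)`, `|β| ≤ 1/(4(N+1)·97²e²)`, `L_s ≥ 1`, `n ≥ 1`, `2R < n`: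
  `|ln Z(L_s³×2n) - 2 ln Z(L_s³×n)| ≤ 24·L_s³n·e^{-(R+1)}` (`Z = wilsonFinTorusPartition ρ β`; the box of period `2n` is written `n + n`).

HONEST FRAMING: strong coupling only; crude constants (`96/97`, `24 = 2·12`); nothing about weak coupling, torons, purity at large `β`, or limits.
-/

noncomputable section

open MeasureTheory Finset
open scoped BigOperators
open Literature.Probability.LatticeModels

namespace Literature.MathematicalPhysics.QuantumFieldTheory

open Literature.Probability.LatticeModels

variable {n₀ n₁ n₂ n : ℕ} {G : Type*} [Group G] [TopologicalSpace G] [IsTopologicalGroup G] [CompactSpace G]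
  [MeasurableSpace G] [BorelSpace G]

section LinkRel

omit [TopologicalSpace G] [IsTopologicalGroup G] [CompactSpace G] [MeasurableSpace G] [BorelSpace G]

/-- On a time ball of radius `R`, `2R < n`, sharing a link is equivalent before and after folding. [cite: SeilerLNP1982, Ch. 2] -/
theorem linkRel_plaqFold_iff' (t₀ : Fin (n + n)) {R : ℕ} (hR : 2 * R < n) {q q' : FinTorusPlaquette n₀ n₁ n₂ (n + n)}
    (hq : finCycDist q.1.2.2.2 t₀ < R) (hq' : finCycDist q'.1.2.2.2 t₀ < R) :
    (finTorusSystem n₀ n₁ n₂ n G).linkRel (plaqFold q) (plaqFold q') ↔ (finTorusSystem n₀ n₁ n₂ (n + n) G).linkRel q q' := by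
  rw [(finTorusSystem n₀ n₁ n₂ n G).linkRel_iff, (finTorusSystem n₀ n₁ n₂ (n + n) G).linkRel_iff]
  simp only [finTorusSystem_edges, finTorusPlaqEdges_plaqFold]
  constructor
  · rintro ⟨e', he'p, he'q⟩
    obtain ⟨e₁, he₁, rfl⟩ := Finset.mem_image.1 he'p
    obtain ⟨e₂, he₂, h12⟩ := Finset.mem_image.1 he'q
    have : e₂ = e₁ := linkFold_injOn_ball t₀ hR hq' hq he₂ he₁ h12
    exact ⟨e₁, he₁, this ▸ he₂⟩
  · rintro ⟨e, hep, heq⟩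
    exact ⟨linkFold e, Finset.mem_image_of_mem linkFold hep, Finset.mem_image_of_mem linkFold heq⟩

end LinkRel

/-! ### The fibres of the covering -/

section Fibres

/-- **The fibres of the covering on plaquettes have exactly two elements** (`n ≥ 1`). [cite: SeilerLNP1982, Ch. 2] -/
theorem card_filter_plaqFold_eq (hn : 0 < n) (p : FinTorusPlaquette n₀ n₁ n₂ n) :
    ((Finset.univ : Finset (FinTorusPlaquette n₀ n₁ n₂ (n + n))).filter fun q => plaqFold q = p).card = 2 := by
  obtain ⟨⟨a, b, c, t₁⟩, pl⟩ := p
  have ht₁ := t₁.isLt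
  rw [Finset.card_eq_two]
  refine ⟨((a, b, c, ⟨t₁, by omega⟩), pl), ((a, b, c, ⟨t₁ + n, by omega⟩), pl), ?_, ?_⟩
  · simp only [ne_eq, Prod.mk.injEq, Fin.mk.injEq, and_true, true_and]
    omega
  · ext q
    obtain ⟨⟨a', b', c', t⟩, pl'⟩ := q
    have ht := t.isLt
    simp only [Finset.mem_filter, Finset.mem_univ, true_and, Finset.mem_insert, Finset.mem_singleton, plaqFold,
      siteFold, Prod.mk.injEq]
    constructor
    · rintro ⟨⟨rfl, rfl, rfl, h⟩, rfl⟩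
      have hv := congrArg Fin.val h
      rw [val_finFold] at hv
      by_cases hlt : (t : ℕ) < n
      · left
        rw [if_pos hlt] at hv
        exact ⟨⟨rfl, rfl, rfl, Fin.ext hv⟩, rfl⟩
      · right
        rw [if_neg hlt] at hv
        exact ⟨⟨rfl, rfl, rfl, Fin.ext (by simp only; omega)⟩, rfl⟩
    · rintro (⟨⟨rfl, rfl, rfl, rfl⟩, rfl⟩ | ⟨⟨rfl, rfl, rfl, rfl⟩, rfl⟩)
      · refine ⟨⟨rfl, rfl, rfl, Fin.ext ?_⟩, rfl⟩
        rw [val_finFold]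
        simp only
        rw [if_pos ht₁]
      · refine ⟨⟨rfl, rfl, rfl, Fin.ext ?_⟩, rfl⟩
        rw [val_finFold]
        simp only
        rw [if_neg (by omega)]
        omega

/-- Summing a function of the folded plaquette over the big box counts every plaquette of the small box twice. [cite: SeilerLNP1982, Ch. 2] -/
theorem sum_comp_plaqFold (hn : 0 < n) {M : Type*} [AddCommMonoid M] (f : FinTorusPlaquette n₀ n₁ n₂ n → M) :
    ∑ q : FinTorusPlaquette n₀ n₁ n₂ (n + n), f (plaqFold q) = 2 • ∑ p : FinTorusPlaquette n₀ n₁ n₂ n, f p := by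
  rw [← Finset.sum_fiberwise_of_maps_to (g := plaqFold) (t := Finset.univ) (fun q _ => Finset.mem_univ _)]
  rw [Finset.smul_sum]
  refine Finset.sum_congr rfl fun p _ => ?_
  rw [Finset.sum_congr rfl fun q hq => by rw [(Finset.mem_filter.1 hq).2], Finset.sum_const, card_filter_plaqFold_eq hn p]

end Fibres

/-! ### The truncated local cluster sums agree along the covering -/

section LocalSums

/-- **★ The size-`R` anchored cluster sum of the box `n₀×n₁×n₂×2n` at `p'` equals that of the box `n₀×n₁×n₂×n` at the folded plaquette**,
for `2R < n`, any measurable family pulled back along the covering, inside the Kotecký–Preiss region (the covering is an isomorphism of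
plaquette–link systems between the time balls of radius `R` about `p'` and about its image, inverse the local section; apply
`PlaquetteSystem.localClusterSum_eq_of_localIso`). [cite: KoteckyPreiss1986, p. 493 (bulk free energy formula)] -/
theorem localClusterSum_plaqFold [SecondCountableTopology G] {Δ : ℕ} (hΔ₁ : ∀ p, ((finTorusSystem n₀ n₁ n₂ n G).nbrs p).card ≤ Δ)
    (hΔ₂ : ∀ p, ((finTorusSystem n₀ n₁ n₂ (n + n) G).nbrs p).card ≤ Δ)
    {w : FinTorusPlaquette n₀ n₁ n₂ n → G → ℝ} (hw : ∀ p, Measurable (w p)) {ε : ℝ} (hε : ∀ p W, |w p W - 1| ≤ ε)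
    (hsmall : ((Δ : ℝ) + 1) ^ 2 * (Real.exp 2 * ε) ≤ 1 / 2) {R : ℕ} (hR : 2 * R < n) (p' : FinTorusPlaquette n₀ n₁ n₂ (n + n)) :
    (finTorusSystem n₀ n₁ n₂ (n + n) G).localClusterSum (fun q => w (plaqFold q)) R p' =
      (finTorusSystem n₀ n₁ n₂ n G).localClusterSum w R (plaqFold p') := by
  refine PlaquetteSystem.localClusterSum_eq_of_localIso (finTorusSystem n₀ n₁ n₂ (n + n) G) (finTorusSystem n₀ n₁ n₂ n G)
    hΔ₂ hΔ₁ (fun p => hw _) (fun p W => hε _ W) hε hsmall (fun q => measurable_finTorusSystem_hol q)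
    (ht := fun q => finCycDist q.1.2.2.2 p'.1.2.2.2) (ht' := fun q₁ => finCycDist q₁.1.2.2.2 (finFold p'.1.2.2.2))
    (fun a b h => finCycDist_lipschitz_linkRel _ a b h) (fun a b h => finCycDist_lipschitz_linkRel _ a b h)
    plaqFold (plaqLift p'.1.2.2.2) linkFold (finCycDist_self _) (finCycDist_self _)
    (fun q hq => (finCycDist_plaqFold_le _ q).trans_lt hq) (fun q₁ hq₁ => by rwa [finCycDist_plaqLift])
    (fun q hq => plaqLift_plaqFold _ q (by omega)) (fun q₁ _ => plaqFold_plaqLift _ q₁)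
    (fun a b ha hb => linkRel_plaqFold_iff' p'.1.2.2.2 hR ha hb)
    (fun a b ha hb e he e' he' h => linkFold_injOn_ball p'.1.2.2.2 hR ha hb he he' h)
    (fun q _ => by rw [finTorusSystem_edges, finTorusSystem_edges, finTorusPlaqEdges_plaqFold])
    (fun q _ U' => by rw [finTorusSystem_hol, finTorusSystem_hol]; exact (finTorusPlaquette_comp_linkFold U' q.1 _ _).symm)
    (fun q _ => rfl)

end LocalSums

/-! ### The comparison of the two boxes -/

section Comparison

variable [SecondCountableTopology G]

omit [TopologicalSpace G] [IsTopologicalGroup G] [CompactSpace G] [MeasurableSpace G] [BorelSpace G] [SecondCountableTopology G] [Group G] in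
/-- A crude size bound: every family of plaquette sets has total size at most `#(Finset P) · #P`. [cite: KoteckyPreiss1986, p. 493 (bulk free energy formula)] -/
theorem sum_card_le_crude {P : Type*} [Fintype P] [DecidableEq P] (C : Finset (Finset P)) :
    ∑ X ∈ C, X.card ≤ Fintype.card (Finset P) * Fintype.card P := by
  calc ∑ X ∈ C, X.card ≤ ∑ _X ∈ C, Fintype.card P := Finset.sum_le_sum fun X _ => Finset.card_le_univ X
    _ = C.card * Fintype.card P := by rw [Finset.sum_const, smul_eq_mul]
    _ ≤ Fintype.card (Finset P) * Fintype.card P := Nat.mul_le_mul_right _ (Finset.card_le_univ C)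

/-- **★★ Aspect comparison along the time covering.**  For a measurable family `w` on the box `n₀×n₁×n₂×n` (`n ≥ 1`) in the Kotecký–Preiss
region (degree bound `Δ` valid on both boxes) and its pull-back to the box `n₀×n₁×n₂×2n`, for every `R` with `2R < n`:
`|ln Z(n₀,n₁,n₂,2n) - 2 ln Z(n₀,n₁,n₂,n)| ≤ 2 · #plaquettes(2n-box) · e^{-(R+1)}` — the bulk cluster sums agree along the `2 : 1` covering and
only the anchored tails (families of total size `> R`, which may wrap the time circle) survive ([KP86] p. 493 "good control of boundary terms").
[cite: KoteckyPreiss1986, p. 493 (bulk free energy formula)] -/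
theorem abs_log_Z_fold_sub_two_mul_le (hn : 0 < n) {Δ : ℕ} (hΔ₁ : ∀ p, ((finTorusSystem n₀ n₁ n₂ n G).nbrs p).card ≤ Δ)
    (hΔ₂ : ∀ p, ((finTorusSystem n₀ n₁ n₂ (n + n) G).nbrs p).card ≤ Δ)
    {w : FinTorusPlaquette n₀ n₁ n₂ n → G → ℝ} (hw : ∀ p, Measurable (w p)) {ε : ℝ} (hε : ∀ p W, |w p W - 1| ≤ ε)
    (hsmall : ((Δ : ℝ) + 1) ^ 2 * (Real.exp 2 * ε) ≤ 1 / 2) {R : ℕ} (hR : 2 * R < n) :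
    |Real.log ((finTorusSystem n₀ n₁ n₂ (n + n) G).Z fun q => w (plaqFold q)) -
        2 * Real.log ((finTorusSystem n₀ n₁ n₂ n G).Z w)| ≤
      2 * (Fintype.card (FinTorusPlaquette n₀ n₁ n₂ (n + n)) : ℝ) * Real.exp (-((R : ℝ) + 1)) := by
  set S₂ := finTorusSystem n₀ n₁ n₂ (n + n) G with hS₂
  set S₁ := finTorusSystem n₀ n₁ n₂ n G with hS₁
  set w₂ : FinTorusPlaquette n₀ n₁ n₂ (n + n) → G → ℝ := fun q => w (plaqFold q) with hw₂
  have hw₂m : ∀ p, Measurable (w₂ p) := fun p => hw _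
  have hε₂ : ∀ p W, |w₂ p W - 1| ≤ ε := fun p W => hε _ W
  set R₂ := Fintype.card (Finset (FinTorusPlaquette n₀ n₁ n₂ (n + n))) * Fintype.card (FinTorusPlaquette n₀ n₁ n₂ (n + n))
  set R₁ := Fintype.card (Finset (FinTorusPlaquette n₀ n₁ n₂ n)) * Fintype.card (FinTorusPlaquette n₀ n₁ n₂ n)
  have hlog₂ := S₂.log_Z_eq_sum_localClusterSum (fun q => measurable_finTorusSystem_hol q) hΔ₂ hw₂m hε₂ hsmall
    (R := R₂) (fun C => sum_card_le_crude C)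
  have hlog₁ := S₁.log_Z_eq_sum_localClusterSum (fun q => measurable_finTorusSystem_hol q) hΔ₁ hw hε hsmall
    (R := R₁) (fun C => sum_card_le_crude C)
  have htail₂ := fun p => S₂.norm_localClusterSum_sub_le hΔ₂ hε₂ hsmall (R := R) (R' := R₂) (fun C => sum_card_le_crude C) p
  have htail₁ := fun p => S₁.norm_localClusterSum_sub_le hΔ₁ hε hsmall (R := R) (R' := R₁) (fun C => sum_card_le_crude C) p
  have hloc : ∀ p', S₂.localClusterSum w₂ R p' = S₁.localClusterSum w R (plaqFold p') := fun p' =>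
    localClusterSum_plaqFold hΔ₁ hΔ₂ hw hε hsmall hR p'
  have key : (∑ p', S₂.localClusterSum w₂ R₂ p') - 2 * ∑ p, S₁.localClusterSum w R₁ p =
      (∑ p', (S₂.localClusterSum w₂ R₂ p' - S₂.localClusterSum w₂ R p')) -
        ∑ p', (S₁.localClusterSum w R₁ (plaqFold p') - S₁.localClusterSum w R (plaqFold p')) := by
    have h2 : ∑ p', S₂.localClusterSum w₂ R p' = 2 * ∑ p, S₁.localClusterSum w R p := by
      simp only [hloc]
      rw [sum_comp_plaqFold hn (fun p => S₁.localClusterSum w R p), nsmul_eq_mul, Nat.cast_ofNat]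
    have h1 : ∑ p' : FinTorusPlaquette n₀ n₁ n₂ (n + n), S₁.localClusterSum w R₁ (plaqFold p') =
        2 * ∑ p, S₁.localClusterSum w R₁ p := by
      rw [sum_comp_plaqFold hn (fun p => S₁.localClusterSum w R₁ p), nsmul_eq_mul, Nat.cast_ofNat]
    have h3 : ∑ p' : FinTorusPlaquette n₀ n₁ n₂ (n + n), S₁.localClusterSum w R (plaqFold p') =
        2 * ∑ p, S₁.localClusterSum w R p := by
      rw [sum_comp_plaqFold hn (fun p => S₁.localClusterSum w R p), nsmul_eq_mul, Nat.cast_ofNat]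
    rw [Finset.sum_sub_distrib, Finset.sum_sub_distrib, h2, h1, h3]
    ring
  have hre : (∑ p', S₂.localClusterSum w₂ R₂ p').re - 2 * (∑ p, S₁.localClusterSum w R₁ p).re =
      ((∑ p', S₂.localClusterSum w₂ R₂ p') - 2 * ∑ p, S₁.localClusterSum w R₁ p).re := by
    simp [Complex.mul_re]
  rw [hlog₂, hlog₁, hre, key]
  refine (Complex.abs_re_le_norm _).trans ((norm_sub_le _ _).trans ?_)
  have hb₂ : ‖∑ p', (S₂.localClusterSum w₂ R₂ p' - S₂.localClusterSum w₂ R p')‖ ≤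
      (Fintype.card (FinTorusPlaquette n₀ n₁ n₂ (n + n)) : ℝ) * Real.exp (-((R : ℝ) + 1)) := by
    refine (norm_sum_le _ _).trans ?_
    refine (Finset.sum_le_sum fun p' _ => htail₂ p').trans ?_
    rw [Finset.sum_const, Finset.card_univ, nsmul_eq_mul]
  have hb₁ : ‖∑ p' : FinTorusPlaquette n₀ n₁ n₂ (n + n),
      (S₁.localClusterSum w R₁ (plaqFold p') - S₁.localClusterSum w R (plaqFold p'))‖ ≤
      (Fintype.card (FinTorusPlaquette n₀ n₁ n₂ (n + n)) : ℝ) * Real.exp (-((R : ℝ) + 1)) := by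
    refine (norm_sum_le _ _).trans ?_
    refine (Finset.sum_le_sum fun p' _ => htail₁ (plaqFold p')).trans ?_
    rw [Finset.sum_const, Finset.card_univ, nsmul_eq_mul]
  linarith

end Comparison

end Literature.MathematicalPhysics.QuantumFieldTheory


namespace Literature.MathematicalPhysics.QuantumFieldTheory

/-! ### Wilson's theory: the strong-coupling aspect comparison `|ln Z(L³×2n) - 2 ln Z(L³×n)| ≤ 24 L³ n e^{-(R+1)}` -/

section Wilson

variable {G : Type*} [Group G] {N : ℕ} (ρ : G →* Matrix (Fin N) (Fin N) ℂ) [TopologicalSpace G]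
  [IsTopologicalGroup G] [CompactSpace G] [MeasurableSpace G] [BorelSpace G] {Ls n : ℕ}

/-- **Bridge (untwisted)**: Wilson's partition function of the box `L_s³ × L_t` is `e^{-βN·#plaquettes}` times the partition function of
the constant Wilson family on `finTorusSystem`. [cite: Tomboulis2007Confinement, §6.1 eq. (6.1) and §6.2 eq. (6.5)] -/
theorem wilsonFinTorusPartition_eq_mul_Z [NeZero Ls] (β : ℝ) (Lt : ℕ) :
    wilsonFinTorusPartition ρ β Ls Ls Ls Lt =
      Real.exp (-(β * N)) ^ Fintype.card (FinTorusPlaquette Ls Ls Ls Lt) *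
        (finTorusSystem Ls Ls Ls Lt G).Z (fun _ W => Real.exp (β * ((ρ W).trace).re)) := by
  rw [← twistedPartitionFunctionAniso_one ρ β Ls Lt ⟨((0 : Fin 4), (1 : Fin 4)), by decide⟩,
    twistedPartitionFunctionAniso_eq_mul_Z ρ β (1 : G), finTorusStackTwist_one, twistFamily_one]

variable [SecondCountableTopology G]

/-- **★★ The strong-coupling aspect comparison for Wilson's theory.**  For second-countable compact `G`, continuous `ρ : G →* M_N(ℂ)`,
`|β| ≤ 1/(4(N+1)·97²e²)`, `L_s ≥ 1`, `n ≥ 1` and `2R < n`: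
`|ln Z(L_s³ × 2n) - 2 ln Z(L_s³ × n)| ≤ 24 · L_s³ n · e^{-(R+1)}` (`Z = wilsonFinTorusPartition ρ β`, the `2n`-box written `n + n`): the bulk free
energy cancels exactly along the `2 : 1` time covering and only clusters of total size `> R` (able to wrap) survive, [KP86] p. 493 / Münster 1981.
[cite: KoteckyPreiss1986, p. 493 (bulk free energy formula)] [cite: Tomboulis2007Confinement, §6.2 eqs. (6.10)–(6.12)] -/
theorem abs_log_wilsonFinTorusPartition_double_sub_le [NeZero Ls] (hρ : Continuous ρ) {β : ℝ}
    (hβ : |β| ≤ 1 / (4 * ((N : ℝ) + 1) * ((97 : ℝ) ^ 2 * Real.exp 2))) (hn : 0 < n) {R : ℕ} (hR : 2 * R < n) :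
    |Real.log (wilsonFinTorusPartition ρ β Ls Ls Ls (n + n)) - 2 * Real.log (wilsonFinTorusPartition ρ β Ls Ls Ls n)| ≤
      24 * ((Ls : ℝ) ^ 3 * n) * Real.exp (-((R : ℝ) + 1)) := by
  set S₂ := finTorusSystem Ls Ls Ls (n + n) G with hS₂
  set S₁ := finTorusSystem Ls Ls Ls n G with hS₁
  set w : FinTorusPlaquette Ls Ls Ls n → G → ℝ := fun _ W => Real.exp (β * ((ρ W).trace).re) with hw
  -- smallness (as in `abs_log_twistedPartitionFunctionAniso_sub_le`)
  have hK : (0 : ℝ) < (97 : ℝ) ^ 2 * Real.exp 2 := by positivity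
  have hNβ : ((N : ℝ) + 1) * |β| ≤ 1 / (4 * ((97 : ℝ) ^ 2 * Real.exp 2)) := by
    have hden : (0 : ℝ) < 4 * ((N : ℝ) + 1) * ((97 : ℝ) ^ 2 * Real.exp 2) := by positivity
    rw [le_div_iff₀ hden] at hβ
    rw [le_div_iff₀ (by positivity)]
    nlinarith [abs_nonneg β]
  have hNβ' : (N : ℝ) * |β| ≤ ((N : ℝ) + 1) * |β| := by nlinarith [abs_nonneg β]
  have he1 : (1 : ℝ) ≤ Real.exp 2 := Real.one_le_exp (by norm_num)
  have hNβ1 : (N : ℝ) * |β| ≤ 1 := by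
    have : 1 / (4 * ((97 : ℝ) ^ 2 * Real.exp 2)) ≤ 1 := by
      rw [div_le_iff₀ (by positivity)]
      nlinarith
    linarith
  have hε : ∀ (p : FinTorusPlaquette Ls Ls Ls n) (W : G), |w p W - 1| ≤ 2 * N * |β| := fun p W =>
    CentralTwist.abs_exp_mul_re_trace_sub_one_le ρ hρ hNβ1 _
  have hsmall : (((96 : ℕ) : ℝ) + 1) ^ 2 * (Real.exp 2 * (2 * N * |β|)) ≤ 1 / 2 := by
    have h := hNβ
    rw [le_div_iff₀ (by positivity)] at h
    norm_num at h ⊢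
    nlinarith [abs_nonneg β, Real.exp_pos 2, hNβ']
  have hwm : ∀ p, Measurable (w p) := fun p => CentralTwist.measurable_exp_mul_re_trace ρ hρ β
  have hmain := abs_log_Z_fold_sub_two_mul_le (n₀ := Ls) (n₁ := Ls) (n₂ := Ls) (G := G) hn
    (card_nbrs_finTorusSystem_le) (card_nbrs_finTorusSystem_le) hwm hε hsmall hR
  -- the two partition functions
  have hZ₂ : 0 < S₂.Z (fun q => w (plaqFold q)) :=
    S₂.Z_pos_of_kpSmall (fun q => measurable_finTorusSystem_hol q) (fun p => hwm (plaqFold p)) (fun p W => hε (plaqFold p) W)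
      hsmall
  have hZ₁ : 0 < S₁.Z w := S₁.Z_pos_of_kpSmall (fun q => measurable_finTorusSystem_hol q) hwm hε hsmall
  have hc₂ : 0 < Real.exp (-(β * N)) ^ Fintype.card (FinTorusPlaquette Ls Ls Ls (n + n)) := pow_pos (Real.exp_pos _) _
  have hc₁ : 0 < Real.exp (-(β * N)) ^ Fintype.card (FinTorusPlaquette Ls Ls Ls n) := pow_pos (Real.exp_pos _) _
  have h2 : wilsonFinTorusPartition ρ β Ls Ls Ls (n + n) =
      Real.exp (-(β * N)) ^ Fintype.card (FinTorusPlaquette Ls Ls Ls (n + n)) * S₂.Z (fun q => w (plaqFold q)) :=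
    wilsonFinTorusPartition_eq_mul_Z ρ β (n + n)
  have h1 : wilsonFinTorusPartition ρ β Ls Ls Ls n =
      Real.exp (-(β * N)) ^ Fintype.card (FinTorusPlaquette Ls Ls Ls n) * S₁.Z w :=
    wilsonFinTorusPartition_eq_mul_Z ρ β n
  have hcard₂ : (Fintype.card (FinTorusPlaquette Ls Ls Ls (n + n)) : ℝ) = 12 * ((Ls : ℝ) ^ 3 * n) := by
    rw [card_finTorusPlaquette]; push_cast; ring
  have hcard₁ : (Fintype.card (FinTorusPlaquette Ls Ls Ls n) : ℝ) = 6 * ((Ls : ℝ) ^ 3 * n) := by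
    rw [card_finTorusPlaquette]; push_cast; ring
  have hlogc : Real.log (Real.exp (-(β * N)) ^ Fintype.card (FinTorusPlaquette Ls Ls Ls (n + n))) =
      2 * Real.log (Real.exp (-(β * N)) ^ Fintype.card (FinTorusPlaquette Ls Ls Ls n)) := by
    rw [Real.log_pow, Real.log_pow, hcard₂, hcard₁]; ring
  rw [h2, h1, Real.log_mul hc₂.ne' hZ₂.ne', Real.log_mul hc₁.ne' hZ₁.ne', hlogc]
  have : 2 * Real.log (Real.exp (-(β * N)) ^ Fintype.card (FinTorusPlaquette Ls Ls Ls n)) +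
      Real.log (S₂.Z fun q => w (plaqFold q)) -
      2 * (Real.log (Real.exp (-(β * N)) ^ Fintype.card (FinTorusPlaquette Ls Ls Ls n)) + Real.log (S₁.Z w)) =
      Real.log (S₂.Z fun q => w (plaqFold q)) - 2 * Real.log (S₁.Z w) := by ring
  rw [this]
  refine hmain.trans (le_of_eq ?_)
  rw [hcard₂]; ring

end Wilson

end Literature.MathematicalPhysics.QuantumFieldTheory

end
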